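import Summits.RiemannHypothesis.RiemannHypothesis.Theorems.PfPersistenceEdgeLawUniversal
import Summits.RiemannHypothesis.RiemannHypothesis.Theorems.PfPersistenceEdgeLawTables
import HarnessLib

/-!
# The edge law on the whole continuum DIAL SPACE and the DIAL LEMMA: the windowed form of every
# real weight table is a `WindowForm` (pub-rhpf, theory-1 gen 5; helper for crux
# `EvenSectorBarta.EvenOneSignedWindows`, item stmt-RiemannHypothesis-19953; RH-free)

**mechanism/rigidity campaign; no RH claims.**  Companion text:
`run/shared/lean/pub/pub-rhpf/pub-rhpf-theory-1/THEORY-EDGE-5.md`.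

`PfPersistenceEdgeLawUniversal` proved the Hadamard–Hellmann–Feynman EDGE LAW `a · ε'(a) = −V(u)`
over the interface `WindowForm` and instantiated it for ζ.  Adjudication A79 of the campaign records
the control families as "per-family instantiation (O1)(O2) routine, not landed"; with the closed
form `tableClosedForm` of `PfPersistenceEdgeLawTables` this file lands it for EVERY REAL WEIGHT
TABLE `w : ℕ → ℝ` at once (all statements PROVED):

## §2 The window bottom of a table and the `WindowForm` instance

* `tableAdm b f` (window-`b` unit states of finite archimedean energy; `weilAdm A b f ↔
  tableAdm b f ∧ b ≤ 2A`), `tableEnergy w b` := the infimum of the closed form over them (the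
  bottom of the FORM DOMAIN; for ζ's table this IS `weilGroundEnergy b`, `tableEnergy_zetaTable`,
  by the tree's `stub_formDomainPos`); `le_tableClosedForm` ((O1): bounded below by
  `ε_ζ(b) − 2·tableDist`), `tableEnergy_le` (the variational principle), `exists_tableAdm`.
* `tableWindowForm A w : WindowForm` (form read at `2A`, `Adm = weilAdm A` — the SAME admissible
  states as ζ, so (O2) dilation covariance is LITERALLY ζ's: `tableWindowForm_dilationCovariantAt`).
* **`mul_deriv_tableEnergy_eq_neg`** — THE EDGE LAW FOR EVERY TABLE: `a · ε_w'(a) = −V` for every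
  ground state at a differentiability window with differentiable profile; one-sided versions
  `neg_le_mul_deriv_tableEnergy` / `mul_deriv_tableEnergy_le_neg`; `antitoneOn_tableEnergy`
  (Bombieri's Thm 5 for tables, from monotone admissibility — no existence of minimisers needed),
  `ae_differentiableAt_tableEnergy`, `ae_mul_deriv_tableEnergy_eq_neg` (the law at a.e. window).

## §3 The continuum DIAL LEMMA

* `abs_tableEnergy_sub_le`: `|ε_w(b) − ε_{w'}(b)| ≤ 2 Σ_{log n < 2b} |w n − w' n|` — the bottom is
  `2`-Lipschitz in the `ℓ¹` distance of the tables on the window's prime index; in particular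
  (`tableEnergy_eq_of_agree`) tables agreeing at `log n < 2b` have the same bottom at `b` (the
  twin wall in energy form), and `abs_tableEnergy_sub_weilGroundEnergy_le` against ζ;
  `isGround_tableWindowForm_zetaTable`: a Weil ground state of ζ is a ground state of ζ's table
  form, so at `w = Λ/√·` the table edge law is the tree's ζ edge law.

So for the control families nothing in the LAW differs from ζ.  Existence of minimisers for a
general table (Bombieri Thm 3 analogue) is not claimed and not needed: the law is per ground state.

References: E. Bombieri, Rend. Mat. Acc. Lincei (9) 11 (2000) 183–233, §4 Thm 3, Thm 5;
T. Kato, *Perturbation Theory for Linear Operators* (1966) VII §4.6, VII §6.5; J. Hadamard (1908).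
-/

set_option linter.dupNamespace false

noncomputable section

open MeasureTheory Set Filter
open scoped Topology ArithmeticFunction.vonMangoldt

namespace Summit.RiemannHypothesis.RiemannHypothesis.Theorems.PfPersistence

open Literature.NumberTheory.LFunctions
open Summit.RiemannHypothesis.RiemannHypothesis.Theorems.WeilWindowFlowWindowLipschitz
  (stub_formDomainPos)
open Summit.RiemannHypothesis.RiemannHypothesis.Theorems.PfPersistenceDownCone (zetaTable)

/-! ## §2 The window bottom of a table; the `WindowForm` instance; the edge law -/

/-- Admissible unit states of the window `[-b, b]` (no reference window): `0 < b`, `f ∈ L²`,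
`f = 0` at every `|x| ≥ b`, unit mass, finite archimedean energy.  (`weilAdm A b f` is exactly
`tableAdm b f ∧ b ≤ 2A`, `weilAdm_iff`.) [folklore] -/
def tableAdm (b : ℝ) (f : ℝ → ℂ) : Prop :=
  0 < b ∧ MemLp f 2 ∧ (∀ x, b ≤ |x| → f x = 0) ∧ (∫ x, ‖f x‖ ^ 2 = (1 : ℝ)) ∧
    IntegrableOn (fun t ↦ weilArchDensity t * weilIncrement f t) (Ioi 0)

/-- `weilAdm A b f ↔ tableAdm b f ∧ b ≤ 2A`. [folklore] -/
theorem weilAdm_iff {A b : ℝ} {f : ℝ → ℂ} : weilAdm A b f ↔ tableAdm b f ∧ b ≤ 2 * A := by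
  unfold weilAdm tableAdm
  tauto

/-- **The window bottom of the table `w`**: the infimum of its closed form over the admissible unit
states of the window (the bottom of the form domain; for ζ's table `= weilGroundEnergy`,
`tableEnergy_zetaTable`). [cite: Bombieri2000Weil, §4 (ground energies)] -/
def tableEnergy (w : ℕ → ℝ) (b : ℝ) : ℝ :=
  sInf (tableClosedForm b w '' {f | tableAdm b f})

/-- Window tests of unit mass are admissible. [folklore] -/
theorem tableAdm_of_isWeilTest {b : ℝ} (hb : 0 < b) {g : ℝ → ℂ} (hg : IsWeilTest g)
    (hsupp : tsupport g ⊆ Icc (-b) b) (hN : ∫ x, ‖g x‖ ^ 2 = (1 : ℝ)) : tableAdm b g :=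
  ⟨hb, hg.memLp_two, fun _ hx ↦ eq_zero_of_le_abs_of_tsupport_subset hg hsupp hx, hN,
    integrableOn_weilArchDensity_mul_weilIncrement hg⟩

/-- The admissible set of a window `b > 0` is nonempty. [folklore] -/
theorem exists_tableAdm {b : ℝ} (hb : 0 < b) : ∃ g : ℝ → ℂ, tableAdm b g := by
  obtain ⟨g, hg, hsupp, hN⟩ := exists_isWeilTest_sphere hb
  exact ⟨g, tableAdm_of_isWeilTest hb hg hsupp hN⟩

/-- Admissibility is monotone in the window. [folklore] -/
theorem tableAdm.mono {b b' : ℝ} {f : ℝ → ℂ} (h : tableAdm b f) (hbb' : b ≤ b') : tableAdm b' f :=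
  ⟨h.1.trans_le hbb', h.2.1, fun x hx ↦ h.2.2.1 x (hbb'.trans hx), h.2.2.2.1, h.2.2.2.2⟩

/-- ζ's variational principle on the form domain (`stub_formDomainPos`): for an admissible unit
state `f` of the window `b`, `ε_ζ(b) ≤ weilClosedForm b f`. [cite: Bombieri2000Weil, §4 Thm 3] -/
theorem weilGroundEnergy_le_weilClosedForm_of_tableAdm {b : ℝ} {f : ℝ → ℂ} (h : tableAdm b f) :
    weilGroundEnergy b ≤ weilClosedForm b f := by
  obtain ⟨hb, hf2, hfs, hN, hE⟩ := h
  have hC1 := stub_formDomainPos b hb f hf2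
    (Eventually.of_forall fun x hx ↦ hfs x (not_le.1 fun h ↦ hx (abs_le.1 h)).le) hE
  rw [hN, mul_one] at hC1
  unfold weilClosedForm
  rw [hN, mul_one]
  linarith

/-- **(O1) for tables — the closed form of a table is bounded below on the form domain of the
window**: `ε_ζ(b) − 2·Σ_{log n < 2b}|w n − Λ(n)/√n| ≤ form_w(f)` for admissible unit `f`. [folklore] -/
theorem le_tableClosedForm {b : ℝ} {f : ℝ → ℂ} (w : ℕ → ℝ) (h : tableAdm b f) :
    weilGroundEnergy b - 2 * tableDist b w zetaTable ≤ tableClosedForm b w f := by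
  have h1 := weilGroundEnergy_le_weilClosedForm_of_tableAdm h
  have h2 := abs_tableClosedForm_sub_le h.2.1 b w zetaTable
  rw [tableClosedForm_zetaTable, h.2.2.2.1, mul_one] at h2
  have h3 := (abs_le.1 h2).1
  linarith

/-- The image of the admissible set under the closed form is bounded below. [folklore] -/
theorem bddBelow_tableClosedForm_image (w : ℕ → ℝ) (b : ℝ) :
    BddBelow (tableClosedForm b w '' {f | tableAdm b f}) := by
  refine ⟨weilGroundEnergy b - 2 * tableDist b w zetaTable, ?_⟩
  rintro _ ⟨f, hf, rfl⟩
  exact le_tableClosedForm w hf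

/-- **The variational principle for tables**: `ε_w(b) ≤ form_w(f)` for every admissible unit state
`f` of the window `b`. [folklore] -/
theorem tableEnergy_le {b : ℝ} {f : ℝ → ℂ} (w : ℕ → ℝ) (h : tableAdm b f) :
    tableEnergy w b ≤ tableClosedForm b w f :=
  csInf_le (bddBelow_tableClosedForm_image w b) ⟨f, h, rfl⟩

/-- Lower bound of the table bottom: `ε_ζ(b) − 2·dist ≤ ε_w(b)` (`b > 0`). [folklore] -/
theorem weilGroundEnergy_sub_le_tableEnergy (w : ℕ → ℝ) {b : ℝ} (hb : 0 < b) :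
    weilGroundEnergy b - 2 * tableDist b w zetaTable ≤ tableEnergy w b := by
  obtain ⟨g, hg⟩ := exists_tableAdm hb
  refine le_csInf ⟨_, g, hg, rfl⟩ ?_
  rintro _ ⟨f, hf, rfl⟩
  exact le_tableClosedForm w hf

/-- **The windowed form of the table `w`** (reference window `2A`): closed form
`tableClosedForm (2A) w`, admissible states `weilAdm A` (the SAME as ζ's), bottom `tableEnergy w`,
variational principle by the window change `2A → b` and `tableEnergy_le`. [cite: Bombieri2000Weil, §4 Thm 3] -/
def tableWindowForm (A : ℝ) (w : ℕ → ℝ) : WindowForm where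
  form := tableClosedForm (2 * A) w
  Adm := weilAdm A
  energy := tableEnergy w
  energy_le := by
    intro b f h
    obtain ⟨h', hbA⟩ := weilAdm_iff.1 h
    rw [tableClosedForm_window w h'.2.1 hbA h'.2.2.1]
    exact tableEnergy_le w h'

/-- **(O2) for tables is ζ's verbatim**: the table form is dilation-covariant at every `a ≤ A`
(same admissible states as `weilWindowForm A`). [cite: Bombieri2000Weil, §4 proof of Thm 5 (the dilation)] -/
theorem tableWindowForm_dilationCovariantAt {A a : ℝ} (w : ℕ → ℝ) (haA : a ≤ A) :
    (tableWindowForm A w).DilationCovariantAt a :=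
  weilWindowForm_dilationCovariantAt haA

/-- The profile of the table form along a state `u`: `η ↦ form_w^{2A}(weilDilate η u)`. [folklore] -/
theorem tableWindowForm_profile (A : ℝ) (w : ℕ → ℝ) (u : ℝ → ℂ) (η : ℝ) :
    (tableWindowForm A w).profile u η = tableClosedForm (2 * A) w (weilDilate η u) := rfl

/-- **THE EDGE LAW FOR EVERY REAL WEIGHT TABLE** (instance of the universal theorem): for a table
`w`, a window `a ≤ A` at which `ε_w` is differentiable, and every ground state `u` of
`tableWindowForm A w` at `a` whose profile `η ↦ form_w^{2A}(u_η)` has derivative `V` at `0`: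
`a · ε_w'(a) = −V`. [cite: Kato1966, VII §4.6 and VII §6.5 (Hellmann–Feynman for forms; forms with varying domain)] -/
theorem mul_deriv_tableEnergy_eq_neg {A a : ℝ} {w : ℕ → ℝ} {u : ℝ → ℂ} (haA : a ≤ A)
    (hu : (tableWindowForm A w).IsGround a u) (hd : DifferentiableAt ℝ (tableEnergy w) a) {V : ℝ}
    (hV : HasDerivAt (fun η : ℝ ↦ tableClosedForm (2 * A) w (weilDilate η u)) V 0) :
    a * deriv (tableEnergy w) a = -V :=
  WindowForm.mul_deriv_energy_eq_neg (tableWindowForm_dilationCovariantAt w haA) hu hd hV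

/-- One-sided edge law for tables (compression side): a right profile derivative `V₊` gives
`−V₊ ≤ a · ε_w'(a)`. [folklore] -/
theorem neg_le_mul_deriv_tableEnergy {A a : ℝ} {w : ℕ → ℝ} {u : ℝ → ℂ} (haA : a ≤ A)
    (hu : (tableWindowForm A w).IsGround a u) (hd : DifferentiableAt ℝ (tableEnergy w) a) {V : ℝ}
    (hV : HasDerivWithinAt (fun η : ℝ ↦ tableClosedForm (2 * A) w (weilDilate η u)) V (Ioi 0) 0) :
    -V ≤ a * deriv (tableEnergy w) a :=
  WindowForm.neg_le_mul_deriv_energy (tableWindowForm_dilationCovariantAt w haA) hu hd hV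

/-- One-sided edge law for tables (expansion side): a left profile derivative `V₋` gives
`a · ε_w'(a) ≤ −V₋`. [folklore] -/
theorem mul_deriv_tableEnergy_le_neg {A a : ℝ} {w : ℕ → ℝ} {u : ℝ → ℂ} (haA : a ≤ A)
    (hu : (tableWindowForm A w).IsGround a u) (hd : DifferentiableAt ℝ (tableEnergy w) a) {V : ℝ}
    (hV : HasDerivWithinAt (fun η : ℝ ↦ tableClosedForm (2 * A) w (weilDilate η u)) V (Iio 0) 0) :
    a * deriv (tableEnergy w) a ≤ -V :=
  WindowForm.mul_deriv_energy_le_neg (tableWindowForm_dilationCovariantAt w haA) hu hd hV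

/-- **The table bottom is antitone** on `(0, ∞)` (Bombieri's Thm 5 for every table; from
monotone admissibility and the window change — no existence of minimisers needed). [cite: Bombieri2000Weil, §4 Thm 5] -/
theorem antitoneOn_tableEnergy (w : ℕ → ℝ) : AntitoneOn (tableEnergy w) (Ioi 0) := by
  intro b hb b' _ hbb'
  have hsub : tableClosedForm b w '' {f | tableAdm b f} ⊆
      tableClosedForm b' w '' {f | tableAdm b' f} := by
    rintro _ ⟨f, hf, rfl⟩
    exact ⟨f, tableAdm.mono hf hbb', tableClosedForm_window w hf.2.1 hbb' hf.2.2.1⟩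
  obtain ⟨g, hg⟩ := exists_tableAdm (mem_Ioi.1 hb)
  exact csInf_le_csInf (bddBelow_tableClosedForm_image w b') ⟨_, g, hg, rfl⟩ hsub

/-- The table bottom is differentiable at almost every window. [folklore] -/
theorem ae_differentiableAt_tableEnergy (w : ℕ → ℝ) :
    ∀ᵐ a : ℝ, 0 < a → DifferentiableAt ℝ (tableEnergy w) a :=
  WindowForm.ae_differentiableAt_energy (W := tableWindowForm 1 w) (antitoneOn_tableEnergy w)

/-- **The edge law for every table at almost every window**: for a.e. `a > 0`, every ground state
`u` of `tableWindowForm a w` at `a` with profile derivative `V` has `a · ε_w'(a) = −V`. [folklore] -/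
theorem ae_mul_deriv_tableEnergy_eq_neg (w : ℕ → ℝ) :
    ∀ᵐ a : ℝ, 0 < a → ∀ (u : ℝ → ℂ) (V : ℝ), (tableWindowForm a w).IsGround a u →
      HasDerivAt (fun η : ℝ ↦ tableClosedForm (2 * a) w (weilDilate η u)) V 0 →
        a * deriv (tableEnergy w) a = -V := by
  filter_upwards [ae_differentiableAt_tableEnergy w] with a ha hpos u V hu hV
  exact mul_deriv_tableEnergy_eq_neg le_rfl hu (ha hpos) hV

/-! ## §3 The continuum dial lemma: the bottom is `2`-Lipschitz in the table -/

/-- Infimum comparison: if `F ≤ G + C` on a nonempty set `S` and `F(S)` is bounded below, then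
`inf F(S) ≤ inf G(S) + C`. [folklore] -/
theorem sInf_image_le_sInf_image_add {α : Type*} {S : Set α} (hne : S.Nonempty) {F G : α → ℝ}
    {C : ℝ} (hF : BddBelow (F '' S)) (hFG : ∀ x ∈ S, F x ≤ G x + C) :
    sInf (F '' S) ≤ sInf (G '' S) + C := by
  have h : ∀ x ∈ S, sInf (F '' S) - C ≤ G x := fun x hx ↦ by
    have h1 := csInf_le hF (mem_image_of_mem F hx)
    linarith [hFG x hx]
  have h2 : sInf (F '' S) - C ≤ sInf (G '' S) :=
    le_csInf (hne.image G) (by rintro _ ⟨x, hx, rfl⟩; exact h x hx)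
  linarith

/-- **THE CONTINUUM DIAL LEMMA**: `|ε_w(b) − ε_{w'}(b)| ≤ 2 Σ_{log n < 2b} |w n − w' n|` for every
window `b > 0` and every two real weight tables. [folklore] -/
theorem abs_tableEnergy_sub_le (w w' : ℕ → ℝ) {b : ℝ} (hb : 0 < b) :
    |tableEnergy w b - tableEnergy w' b| ≤ 2 * tableDist b w w' := by
  have hne : ({f : ℝ → ℂ | tableAdm b f}).Nonempty := exists_tableAdm hb
  have hpt : ∀ (v v' : ℕ → ℝ), ∀ f ∈ {f : ℝ → ℂ | tableAdm b f},
      tableClosedForm b v f ≤ tableClosedForm b v' f + 2 * tableDist b v v' := by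
    intro v v' f hf
    have h := abs_tableClosedForm_sub_le hf.2.1 b v v'
    rw [hf.2.2.2.1, mul_one] at h
    linarith [(abs_le.1 h).2]
  have h1 := sInf_image_le_sInf_image_add hne (bddBelow_tableClosedForm_image w b) (hpt w w')
  have h2 := sInf_image_le_sInf_image_add hne (bddBelow_tableClosedForm_image w' b) (hpt w' w)
  rw [tableDist_comm] at h2
  unfold tableEnergy
  rw [abs_le]
  constructor <;> linarith

/-- **The twin wall in energy form**: tables agreeing at every `log n < 2b` have the same bottom at
`b`. [folklore] -/
theorem tableEnergy_eq_of_agree {w w' : ℕ → ℝ} {b : ℝ} (hb : 0 < b)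
    (h : ∀ n : ℕ, Real.log n < 2 * b → w n = w' n) : tableEnergy w b = tableEnergy w' b := by
  have h1 := abs_tableEnergy_sub_le w w' hb
  rw [tableDist_eq_zero_of_agree h, mul_zero] at h1
  have h2 := abs_nonneg (tableEnergy w b - tableEnergy w' b)
  have h3 : |tableEnergy w b - tableEnergy w' b| = 0 := le_antisymm h1 h2
  rw [abs_eq_zero, sub_eq_zero] at h3
  exact h3

/-- **ζ's table bottom IS the tree's ground energy**: `tableEnergy (Λ/√·) b = weilGroundEnergy b`
(`≥` by `stub_formDomainPos`; `≤` because window tests are admissible and the closed form is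
`Re Q` on them). [cite: Bombieri2000Weil, §4 Thm 3] -/
theorem tableEnergy_zetaTable {b : ℝ} (hb : 0 < b) : tableEnergy zetaTable b = weilGroundEnergy b := by
  refine le_antisymm ?_ ?_
  · -- `≤`: every value `Re Q(g)` of the test sphere is a value of the closed form on `tableAdm b`
    obtain ⟨g₀, hg₀, hs₀, hN₀⟩ := exists_isWeilTest_sphere hb
    unfold weilGroundEnergy
    refine le_csInf ⟨_, g₀, hg₀, hs₀, hN₀, rfl⟩ ?_
    rintro x ⟨g, hg, hs, hN, rfl⟩
    calc tableEnergy zetaTable b ≤ tableClosedForm b zetaTable g :=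
          tableEnergy_le zetaTable (tableAdm_of_isWeilTest hb hg hs hN)
      _ = (weilQuadratic g).re := by
          rw [tableClosedForm_zetaTable, weilClosedForm_eq_re_weilQuadratic hg hs]
  · -- `≥`: the variational principle on the form domain
    have h := weilGroundEnergy_sub_le_tableEnergy zetaTable hb
    rwa [tableDist_self, mul_zero, sub_zero] at h

/-- **Dial lemma against ζ**: `|ε_w(b) − ε_ζ(b)| ≤ 2 Σ_{log n < 2b} |w n − Λ(n)/√n|` (`b > 0`). [folklore] -/
theorem abs_tableEnergy_sub_weilGroundEnergy_le (w : ℕ → ℝ) {b : ℝ} (hb : 0 < b) :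
    |tableEnergy w b - weilGroundEnergy b| ≤ 2 * tableDist b w zetaTable := by
  rw [← tableEnergy_zetaTable hb]
  exact abs_tableEnergy_sub_le w zetaTable hb

/-- A Weil ground state of ζ at the window `a ≤ A` is a ground state of ζ's TABLE form
`tableWindowForm A (Λ/√·)` (so the table edge law at `w = Λ/√·` is the tree's ζ edge law). [cite: Bombieri2000Weil, §4 Thm 3] -/
theorem isGround_tableWindowForm_zetaTable {A a : ℝ} {u : ℝ → ℂ} (hu : IsWeilGroundState a u)
    (haA : a ≤ A) : (tableWindowForm A zetaTable).IsGround a (weilTrunc a u) := by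
  have h := isGround_weilWindowForm hu haA
  refine ⟨h.1, ?_⟩
  show tableClosedForm (2 * A) zetaTable (weilTrunc a u) = tableEnergy zetaTable a
  rw [tableClosedForm_zetaTable, tableEnergy_zetaTable hu.pos]
  exact h.2

end Summit.RiemannHypothesis.RiemannHypothesis.Theorems.PfPersistence

end
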